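import Mathlib

/-!
# Skew-cut X0 certificate: the transcript-shaped facts are invariant under an orbit-compatible
# orthogonal change of the head / shell bases (AUDIT semantics made kernel)
(instab3 g6 — implementation 1 of the skew-cut X0 certifier, cell `ns-blowup`, 2026-08-27)

HONEST FRAMING (human rulings D-0035/D-0074): nothing here is a claim about Navier–Stokes
blow-up. WHAT THIS IS NOT: not NS evidence. MODEL-lane format bookkeeping; no certificate, printed
number or census word is moved.

The class-II END theorems (`AbcClassIISections.isLinNSEigenvalue_of_certificate`, instab4 g6;
`AbcClassIIOpenBracketCertificate.isLinNSEigenvalue_Ioo_of_certificate`, instab3 g6) take the three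
transcript-shaped facts — (T1) `det A(x₁)·det A(x₂) < 0` for the head matrices, (T2) the shell form
`μ (w⬝w) ≤ Σ λ_i w_i² − s (w⬝w) − w⬝(C A⁻¹ B)w`, (T3) tail numbers — about the kernel's OWN section
matrices, written in the existential orbit-adapted basis `bfam` (`stdOrthonormalBasis` per orbit). The
certifiers (i3cert, cert.py) verify the same facts for THEIR matrices, written in their own explicit
real orthonormal bases of the SAME per-orbit real class-II spaces. Two such bases differ by an
orthogonal matrix `Q` which is block-diagonal over orbits, hence preserves the head and shell index
sets and commutes with the level diagonal (levels `|O|²/R` are constant on orbits). This file proves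
that (T1) and (T2) are INVARIANT under such a change ((T3) is basis-free):

* `det_conj_orthogonal` — `det(Qᵀ A Q) = det A` for `Qᵀ Q = 1`;
* `inv_conj_orthogonal` — `(Qᵀ A Q)⁻¹ = Qᵀ A⁻¹ Q` (invertible `A`);
* `transcripts_of_conjugate` — if (T1), (T2) hold for the conjugated data
  `A'_e = Qhᵀ A_e Qh`, `B'_e = Qhᵀ B_e Qp`, `C'_e = Qpᵀ C_e Qh` with `Qh`, `Qp` orthogonal and
  `Qp Λ_e Qpᵀ = Λ_e`, then they hold for `A_e, B_e, C_e, Λ_e` — so the CERTIFIER AUDIT has to confirm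
  exactly: the certifier's basis is a real orthonormal basis of the same per-orbit spaces (block
  orthogonal `Q`) and its matrices are the conjugates; the kernel carries the rest.

Generic (any finite head / shell types); Mathlib only; no definitions. [folklore]
-/

namespace Summit.NavierStokesRegularity.FluidComputer.SkewCutGalerkinTranscriptInvariance

open Matrix
open scoped BigOperators Matrix

variable {m p : Type*} [Fintype m] [Fintype p] [DecidableEq m] [DecidableEq p]

/-- An orthogonal matrix is also a right inverse of its transpose: `Qᵀ Q = 1 ⇒ Q Qᵀ = 1`. -/
theorem mul_transpose_eq_one_of_transpose_mul {n : Type*} [Fintype n] [DecidableEq n]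
    (Q : Matrix n n ℝ) (hQ : Qᵀ * Q = 1) : Q * Qᵀ = 1 :=
  mul_eq_one_comm.mp hQ

/-- `det (Qᵀ A Q) = det A` for orthogonal `Q`. -/
theorem det_conj_orthogonal (A Q : Matrix m m ℝ) (hQ : Qᵀ * Q = 1) : (Qᵀ * A * Q).det = A.det := by
  have h1 : Qᵀ.det * Q.det = 1 := by rw [← det_mul, hQ, det_one]
  rw [det_mul, det_mul, mul_comm Qᵀ.det, mul_assoc, h1, mul_one]

/-- `(Qᵀ A Q)⁻¹ = Qᵀ A⁻¹ Q` for orthogonal `Q` and invertible `A`. -/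
theorem inv_conj_orthogonal (A Q : Matrix m m ℝ) (hQ : Qᵀ * Q = 1) (hA : A.det ≠ 0) :
    (Qᵀ * A * Q)⁻¹ = Qᵀ * A⁻¹ * Q := by
  have hQQ : Q * Qᵀ = 1 := mul_transpose_eq_one_of_transpose_mul Q hQ
  have hAinv : A⁻¹ * A = 1 := nonsing_inv_mul A (isUnit_iff_ne_zero.mpr hA)
  refine inv_eq_left_inv ?_
  calc Qᵀ * A⁻¹ * Q * (Qᵀ * A * Q) = Qᵀ * A⁻¹ * (Q * Qᵀ) * A * Q := by
        simp only [Matrix.mul_assoc]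
    _ = 1 := by rw [hQQ, Matrix.mul_one, Matrix.mul_assoc Qᵀ, hAinv, Matrix.mul_one, hQ]

omit [DecidableEq p] in
/-- Quadratic-form transport: `(Qᵀ w) ⬝ (M (Qᵀ w)) = w ⬝ ((Q M Qᵀ) w)`. -/
theorem dotProduct_conj (M Q : Matrix p p ℝ) (w : p → ℝ) :
    (Qᵀ *ᵥ w) ⬝ᵥ (M *ᵥ (Qᵀ *ᵥ w)) = w ⬝ᵥ ((Q * M * Qᵀ) *ᵥ w) := by
  nth_rewrite 1 [mulVec_transpose]
  rw [← dotProduct_mulVec, mulVec_mulVec, mulVec_mulVec]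

/-- The square norm is invariant: `(Qᵀ w) ⬝ (Qᵀ w) = w ⬝ w` for orthogonal `Q`. -/
theorem dotProduct_self_conj (Q : Matrix p p ℝ) (hQ : Qᵀ * Q = 1) (w : p → ℝ) :
    (Qᵀ *ᵥ w) ⬝ᵥ (Qᵀ *ᵥ w) = w ⬝ᵥ w := by
  have hQQ : Q * Qᵀ = 1 := mul_transpose_eq_one_of_transpose_mul Q hQ
  have h := dotProduct_conj (1 : Matrix p p ℝ) Q w
  rw [Matrix.one_mulVec, Matrix.mul_one, hQQ, Matrix.one_mulVec] at h
  exact h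

/-- The weighted square sum `Σ λ_i w_i²` is `w ⬝ (diagonal λ) w`. -/
theorem sum_mul_sq_eq_dotProduct_diagonal (lam : p → ℝ) (w : p → ℝ) :
    ∑ i, lam i * w i ^ 2 = w ⬝ᵥ (diagonal lam *ᵥ w) := by
  rw [dotProduct]
  exact Finset.sum_congr rfl fun i _ => by rw [mulVec_diagonal]; ring

/-- **(T1) and (T2) are invariant under an orbit-compatible orthogonal change of basis.** Head type
`m`, shell type `p`; at each end `e = 1, 2` the head matrix `A_e`, the couplings `B_e : m × p`,
`C_e : p × m`, the shell levels `Λ_e = diagonal lam_e`; orthogonal `Qh` (head) and `Qp` (shell) with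
`Qp Λ_e Qpᵀ = Λ_e` (levels constant on the blocks of `Qp`). If the head determinant signs are
opposite and the shell forms hold with constants `μ_e` for the CONJUGATED data
`A'_e = Qhᵀ A_e Qh`, `B'_e = Qhᵀ B_e Qp`, `C'_e = Qpᵀ C_e Qh`, then the same holds for the
original data. -/
theorem transcripts_of_conjugate (A₁ A₂ : Matrix m m ℝ) (B₁ B₂ : Matrix m p ℝ) (C₁ C₂ : Matrix p m ℝ)
    (lam₁ lam₂ : p → ℝ) (s μ₁ μ₂ : ℝ) (Qh : Matrix m m ℝ) (Qp : Matrix p p ℝ)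
    (hQh : Qhᵀ * Qh = 1) (hQp : Qpᵀ * Qp = 1)
    (hΛ₁ : Qp * diagonal lam₁ * Qpᵀ = diagonal lam₁) (hΛ₂ : Qp * diagonal lam₂ * Qpᵀ = diagonal lam₂)
    (hsign' : (Qhᵀ * A₁ * Qh).det * (Qhᵀ * A₂ * Qh).det < 0)
    (hX₁' : ∀ w : p → ℝ, μ₁ * (w ⬝ᵥ w) ≤ ∑ i, lam₁ i * w i ^ 2 - s * (w ⬝ᵥ w) -
      w ⬝ᵥ (((Qpᵀ * C₁ * Qh) * (Qhᵀ * A₁ * Qh)⁻¹ * (Qhᵀ * B₁ * Qp)) *ᵥ w))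
    (hX₂' : ∀ w : p → ℝ, μ₂ * (w ⬝ᵥ w) ≤ ∑ i, lam₂ i * w i ^ 2 - s * (w ⬝ᵥ w) -
      w ⬝ᵥ (((Qpᵀ * C₂ * Qh) * (Qhᵀ * A₂ * Qh)⁻¹ * (Qhᵀ * B₂ * Qp)) *ᵥ w)) :
    A₁.det * A₂.det < 0 ∧
    (∀ w : p → ℝ, μ₁ * (w ⬝ᵥ w) ≤ ∑ i, lam₁ i * w i ^ 2 - s * (w ⬝ᵥ w) -
      w ⬝ᵥ ((C₁ * A₁⁻¹ * B₁) *ᵥ w)) ∧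
    (∀ w : p → ℝ, μ₂ * (w ⬝ᵥ w) ≤ ∑ i, lam₂ i * w i ^ 2 - s * (w ⬝ᵥ w) -
      w ⬝ᵥ ((C₂ * A₂⁻¹ * B₂) *ᵥ w)) := by
  have hQhQh : Qh * Qhᵀ = 1 := mul_transpose_eq_one_of_transpose_mul Qh hQh
  have hQpQp : Qp * Qpᵀ = 1 := mul_transpose_eq_one_of_transpose_mul Qp hQp
  -- (T1)
  rw [det_conj_orthogonal A₁ Qh hQh, det_conj_orthogonal A₂ Qh hQh] at hsign'
  have hA₁ : A₁.det ≠ 0 := fun h => by rw [h, zero_mul] at hsign'; exact lt_irrefl _ hsign'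
  have hA₂ : A₂.det ≠ 0 := fun h => by rw [h, mul_zero] at hsign'; exact lt_irrefl _ hsign'
  -- the conjugated Schur block
  have hS : ∀ (A : Matrix m m ℝ) (B : Matrix m p ℝ) (C : Matrix p m ℝ), A.det ≠ 0 →
      (Qpᵀ * C * Qh) * (Qhᵀ * A * Qh)⁻¹ * (Qhᵀ * B * Qp) = Qpᵀ * (C * A⁻¹ * B) * Qp := by
    intro A B C hA
    rw [inv_conj_orthogonal A Qh hQh hA]
    calc Qpᵀ * C * Qh * (Qhᵀ * A⁻¹ * Qh) * (Qhᵀ * B * Qp)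
        = Qpᵀ * C * (Qh * Qhᵀ) * A⁻¹ * (Qh * Qhᵀ) * B * Qp := by simp only [Matrix.mul_assoc]
      _ = Qpᵀ * (C * A⁻¹ * B) * Qp := by rw [hQhQh]; simp only [Matrix.mul_one, Matrix.mul_assoc]
  -- (T2) transport: apply the primed form to `Qpᵀ w`
  have hT : ∀ (A : Matrix m m ℝ) (B : Matrix m p ℝ) (C : Matrix p m ℝ) (lam : p → ℝ) (μ : ℝ),
      A.det ≠ 0 → Qp * diagonal lam * Qpᵀ = diagonal lam →
      (∀ w : p → ℝ, μ * (w ⬝ᵥ w) ≤ ∑ i, lam i * w i ^ 2 - s * (w ⬝ᵥ w) -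
        w ⬝ᵥ (((Qpᵀ * C * Qh) * (Qhᵀ * A * Qh)⁻¹ * (Qhᵀ * B * Qp)) *ᵥ w)) →
      ∀ w : p → ℝ, μ * (w ⬝ᵥ w) ≤ ∑ i, lam i * w i ^ 2 - s * (w ⬝ᵥ w) -
        w ⬝ᵥ ((C * A⁻¹ * B) *ᵥ w) := by
    intro A B C lam μ hA hΛ hX w
    have h := hX (Qpᵀ *ᵥ w)
    rw [hS A B C hA, dotProduct_self_conj Qp hQp, sum_mul_sq_eq_dotProduct_diagonal,
      dotProduct_conj, hΛ, ← sum_mul_sq_eq_dotProduct_diagonal, dotProduct_conj] at h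
    have e : Qp * (Qpᵀ * (C * A⁻¹ * B) * Qp) * Qpᵀ = C * A⁻¹ * B := by
      calc Qp * (Qpᵀ * (C * A⁻¹ * B) * Qp) * Qpᵀ = (Qp * Qpᵀ) * (C * A⁻¹ * B) * (Qp * Qpᵀ) := by
            simp only [Matrix.mul_assoc]
        _ = C * A⁻¹ * B := by rw [hQpQp, Matrix.one_mul, Matrix.mul_one]
    rw [e] at h
    exact h
  exact ⟨hsign', hT A₁ B₁ C₁ lam₁ μ₁ hA₁ hΛ₁ hX₁', hT A₂ B₂ C₂ lam₂ μ₂ hA₂ hΛ₂ hX₂'⟩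

end Summit.NavierStokesRegularity.FluidComputer.SkewCutGalerkinTranscriptInvariance
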